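import Mathlib
import Summits.ValiantsHypothesis.ValiantsHypothesis.Theorems.DivisionGapPerCofactorDegreeReductionStubHiddenRankOne
import Summits.ValiantsHypothesis.ValiantsHypothesis.Theorems.DivisionGapPerCofactorDegreeReductionStubHiddenRankOneRealDescent

/-!
# Crux `DivisionGap.PerCofactorDegreeReduction` (stmt-ValiantsHypothesis-15046), line `Sketch` —
# stub `stub_hiddenRankOneReal`: hidden rank one with REAL homogeneous factors

**Theorem (`stub_hiddenRankOneReal`).** Let `n ≥ 3` and let `a₁, a₂, b₁, b₂ ∈ ℝ≥0[x_ij]` (`n × n`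
variables) be homogeneous of the same degree `d`, none of them divisible by `per_n` over `ℝ`, with
`per_n ∣ a₁ a₂ + b₁ b₂` over `ℝ` and no antipodal cross pair (`per_n ∤ a₁ + c b₁, a₂ + c b₁,
b₂ + c a₁, b₂ + c a₂` over `ℝ` for every real `c > 0`).  Then there are REAL polynomials
`s, t, u, v`, homogeneous of positive degrees `dₛ, dₜ, dᵤ, dᵥ` with
`dₛ + dₜ = dₛ + dᵤ = dᵤ + dᵥ = d`, such that over `ℝ`: `per_n ∣ a₁ - s t`, `per_n ∣ b₁ - s u`,
`per_n ∣ a₂ - u v`, `per_n ∣ b₂ + t v`.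

## Proof

Work in `S = ℂ[x]/(per_n)`, a domain and a UFD for `n ≥ 3` (tree theorem
`Summit.ValiantsHypothesis.Theorems.permQuot_isDomain_and_ufm`), graded by total degree
(`Literature.RingTheory.GradedAlgebra.quotGrading`) with degree-`0` part `ℂ`; bars denote classes of
complexifications, `ā₁ ā₂ + b̄₁ b̄₂ = 0`, all four classes nonzero and homogeneous of degree `d`.
* §1 *Hidden rank one* (verbatim the construction of `HiddenRankOne.stub_hiddenRankOne`, re-run
  because its statement does not record the gcd normalisation): `s := gcd(ā₁, b̄₁)`, `ā₁ = s t`,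
  `b̄₁ = s u` with `gcd(t, u)` a unit (`extract_gcd`), `ā₂ = u v`, `b̄₂ = -(t v)` by coprime
  cancellation; none of `s, t, u, v` is a unit, else two members of a cross pair would differ by a
  nonzero constant, real by descent, whose sign yields an excluded antipodal cross pair.
* §2 *Reality.* Complex conjugation `τ` of `S` (helper file `…RealDescent`: `exists_conjQuot`) is a
  ring involution fixing `ā₁, b̄₁, ā₂, b̄₂`.  So `τ s` divides `ā₁` and `b̄₁`, hence `s`; applying
  `τ`, `s ∣ τ s`: `τ s = λ s` with `λ` a unit, i.e. a constant, and `τ (τ s) = s` gives `λ̄ λ = 1`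
  (`per_n` divides no nonzero constant).  With `μ² = λ`, `μ̄ μ = 1`, the rescaled
  `s' = μ s, t' = μ̄ t, u' = μ̄ u, v' = μ v` have the same pairwise products, are non-units, and are
  ALL fixed by `τ` (`τ s' = μ̄ λ s = μ s`; then cancel `s'` in `s' t' = ā₁ = τ(s' t') = s' τ t'`,
  etc.).
* §3 *Degrees and real representatives.* Divisors of nonzero homogeneous elements of a graded
  domain are homogeneous with degrees adding up (`exists_mem_mem_of_mul_mem`), non-units have
  positive degree, and a `τ`-fixed homogeneous class is the class of a real homogeneous polynomial
  (real part of a representative, `exists_real_of_conjQuot_eq`).  Divisibility over `ℂ` of real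
  polynomials descends to `ℝ` (`TwoTowerCollapse.per_descent`).
-/

noncomputable section

-- `Summit.ValiantsHypothesis.ValiantsHypothesis.…` is the tree's mandated single-conjunct layout
-- (Problem = Summit), so the duplicated namespace component is intended.
set_option linter.dupNamespace false

namespace Summit.ValiantsHypothesis.ValiantsHypothesis.Theorems.DivisionGap.PerCofactorDegreeReduction.HiddenRankOneReal

open MvPolynomial Literature.Computability.AlgebraicComplexity
open Summit.ValiantsHypothesis.ValiantsHypothesis.Theorems.DivisionGap.PerCofactorDegreeReduction.TwoTowerCollapse
  (per_descent per_ascent dvd_of_map_dvd_sub_C_mul)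
open scoped NNReal

/-- **stub_hiddenRankOneReal — BALANCED CREATION IDENTITIES are hidden rank one over `ℝ`.**
For `n ≥ 3`, homogeneous `a₁, a₂, b₁, b₂ ∈ ℝ≥0[x_ij]` of one degree `d`, none divisible by
`per_n` over `ℝ`, with `per_n ∣ a₁ a₂ + b₁ b₂` over `ℝ` and no antipodal cross pair, there are
REAL HOMOGENEOUS `s, t, u, v` of positive degrees `dₛ + dₜ = dₛ + dᵤ = dᵤ + dᵥ = d` with
`a₁ ≡ s t`, `b₁ ≡ s u`, `a₂ ≡ u v`, `b₂ ≡ -(t v)` modulo `per_n` over `ℝ`.  Proof: in the graded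
UFD `S_n = ℂ[x]/(per_n)` (`Summit.ValiantsHypothesis.Theorems.permQuot_isDomain_and_ufm`) run the
hidden-rank-one construction (`s = gcd(ā₁, b̄₁)`, coprime cancellation, non-units by the excluded
antipodal cross pairs, as in `HiddenRankOne.stub_hiddenRankOne`); complex conjugation `τ` of
`S_n` fixes `ā₁, b̄₁`, so `τ s ∼ s`, `τ s = λ s` with `|λ| = 1`; rescaling by `μ = √λ` makes all
four factors `τ`-fixed; they are homogeneous as divisors of homogeneous elements, of positive
degree as non-units, and `τ`-fixed homogeneous classes lift to real homogeneous polynomials (real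
parts of representatives). [abc-tower-collapse, Lever; prime-walk-positivizer] -/
theorem stub_hiddenRankOneReal (n d : ℕ) (hn : 3 ≤ n)
    (a₁ a₂ b₁ b₂ : MvPolynomial (Fin n × Fin n) ℝ≥0)
    (ha₁ : a₁.IsHomogeneous d) (ha₂ : a₂.IsHomogeneous d)
    (hb₁ : b₁.IsHomogeneous d) (hb₂ : b₂.IsHomogeneous d)
    (hdvd : perPoly (Fin n) ℝ ∣ MvPolynomial.map NNReal.toRealHom (a₁ * a₂ + b₁ * b₂))
    (hna₁ : ¬ perPoly (Fin n) ℝ ∣ MvPolynomial.map NNReal.toRealHom a₁)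
    (hna₂ : ¬ perPoly (Fin n) ℝ ∣ MvPolynomial.map NNReal.toRealHom a₂)
    (hnb₁ : ¬ perPoly (Fin n) ℝ ∣ MvPolynomial.map NNReal.toRealHom b₁)
    (hnb₂ : ¬ perPoly (Fin n) ℝ ∣ MvPolynomial.map NNReal.toRealHom b₂)
    (hcross : ∀ c : ℝ≥0, 0 < c →
      ¬ perPoly (Fin n) ℝ ∣ MvPolynomial.map NNReal.toRealHom (a₁ + c • b₁) ∧
      ¬ perPoly (Fin n) ℝ ∣ MvPolynomial.map NNReal.toRealHom (a₂ + c • b₁) ∧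
      ¬ perPoly (Fin n) ℝ ∣ MvPolynomial.map NNReal.toRealHom (b₂ + c • a₁) ∧
      ¬ perPoly (Fin n) ℝ ∣ MvPolynomial.map NNReal.toRealHom (b₂ + c • a₂)) :
    ∃ (ds dt du dv : ℕ) (s t u v : MvPolynomial (Fin n × Fin n) ℝ),
      s.IsHomogeneous ds ∧ t.IsHomogeneous dt ∧ u.IsHomogeneous du ∧ v.IsHomogeneous dv ∧
      1 ≤ ds ∧ 1 ≤ dt ∧ 1 ≤ du ∧ 1 ≤ dv ∧ ds + dt = d ∧ ds + du = d ∧ du + dv = d ∧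
      perPoly (Fin n) ℝ ∣ MvPolynomial.map NNReal.toRealHom a₁ - s * t ∧
      perPoly (Fin n) ℝ ∣ MvPolynomial.map NNReal.toRealHom b₁ - s * u ∧
      perPoly (Fin n) ℝ ∣ MvPolynomial.map NNReal.toRealHom a₂ - u * v ∧
      perPoly (Fin n) ℝ ∣ MvPolynomial.map NNReal.toRealHom b₂ + t * v := by
  classical
  -- `S_n = ℂ[x]/(per_n)`: a domain and a UFD, graded by total degree, degree-0 part `ℂ`
  obtain ⟨hdom, hufm⟩ := Summit.ValiantsHypothesis.Theorems.permQuot_isDomain_and_ufm hn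
  letI := MvPolynomial.gradedAlgebra (σ := Fin n × Fin n) (R := ℂ)
  have hhom : (Ideal.span {perPoly (Fin n) ℂ}).IsHomogeneous
      (homogeneousSubmodule (Fin n × Fin n) ℂ) :=
    Ideal.homogeneous_span _ _ fun x hx => by
      rw [Set.mem_singleton_iff] at hx
      subst hx
      exact ⟨_, (mem_homogeneousSubmodule _ _).2 perPoly_isHomogeneous⟩
  letI : GradedAlgebra (Literature.RingTheory.GradedAlgebra.quotGrading
      (homogeneousSubmodule (Fin n × Fin n) ℂ) (Ideal.span {perPoly (Fin n) ℂ})) :=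
    Literature.RingTheory.GradedAlgebra.quotGrading.gradedAlgebra
      (homogeneousSubmodule (Fin n × Fin n) ℂ) ⟨Ideal.span {perPoly (Fin n) ℂ}, hhom⟩
  -- the reduction map `Φ : ℝ≥0[x] → ℝ[x] → ℂ[x] → S_n`
  obtain ⟨Φ, hΦdef⟩ : ∃ Φ : MvPolynomial (Fin n × Fin n) ℝ≥0 →+*
      MvPolynomial (Fin n × Fin n) ℂ ⧸ Ideal.span {perPoly (Fin n) ℂ},
      Φ = (Ideal.Quotient.mk (Ideal.span {perPoly (Fin n) ℂ})).comp
        ((MvPolynomial.map Complex.ofRealHom).comp (MvPolynomial.map NNReal.toRealHom)) :=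
    ⟨_, rfl⟩
  have hΦ : ∀ p, Φ p = Ideal.Quotient.mk (Ideal.span {perPoly (Fin n) ℂ})
      (MvPolynomial.map Complex.ofRealHom (MvPolynomial.map NNReal.toRealHom p)) := fun p => by
    rw [hΦdef]; rfl
  have hΦ0 : ∀ p, Φ p = 0 ↔ perPoly (Fin n) ℂ ∣
      MvPolynomial.map Complex.ofRealHom (MvPolynomial.map NNReal.toRealHom p) := fun p => by
    rw [hΦ, Ideal.Quotient.eq_zero_iff_mem, Ideal.mem_span_singleton]
  have hΦC : ∀ (b : ℝ≥0) (p : MvPolynomial (Fin n × Fin n) ℝ≥0),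
      Φ (b • p) = Ideal.Quotient.mk (Ideal.span {perPoly (Fin n) ℂ}) (C ((b : ℝ) : ℂ)) * Φ p := by
    intro b p
    simp only [hΦ, smul_eq_C_mul, map_mul, MvPolynomial.map_C]
    rfl
  -- homogeneous of degree `d` stays homogeneous of degree `d` in `S_n`
  have hmem : ∀ V : MvPolynomial (Fin n × Fin n) ℝ≥0, V.IsHomogeneous d →
      Φ V ∈ Literature.RingTheory.GradedAlgebra.quotGrading
        (homogeneousSubmodule (Fin n × Fin n) ℂ) (Ideal.span {perPoly (Fin n) ℂ}) d :=
    fun V hV => by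
      rw [hΦ]
      exact Literature.RingTheory.GradedAlgebra.mk_mem_quotGrading
        ((mem_homogeneousSubmodule _ _).2 ((hV.map _).map _))
  -- the relation in `S_n` and the non-vanishing of `ā₁`, `ā₂`, `b̄₁`, `b̄₂`
  have hrel : Φ a₁ * Φ a₂ + Φ b₁ * Φ b₂ = 0 := by
    rw [← map_mul, ← map_mul, ← map_add, hΦ0]
    exact per_ascent hdvd
  have hA₁ : Φ a₁ ≠ 0 := fun h => hna₁ (per_descent ((hΦ0 a₁).1 h))
  have hA₂ : Φ a₂ ≠ 0 := fun h => hna₂ (per_descent ((hΦ0 a₂).1 h))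
  have hB₁ : Φ b₁ ≠ 0 := fun h => hnb₁ (per_descent ((hΦ0 b₁).1 h))
  have hB₂ : Φ b₂ ≠ 0 := fun h => hnb₂ (per_descent ((hΦ0 b₂).1 h))
  -- a constant proportionality inside a cross pair contradicts `hcross`
  have hfin : ∀ (X₁ Y₁ X₂ Y₂ : MvPolynomial (Fin n × Fin n) ℝ≥0) (c : ℂ), c ≠ 0 →
      Φ X₁ = Ideal.Quotient.mk (Ideal.span {perPoly (Fin n) ℂ}) (C c) * Φ Y₁ →
      Φ X₁ * Φ X₂ + Φ Y₁ * Φ Y₂ = 0 →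
      ¬ perPoly (Fin n) ℝ ∣ MvPolynomial.map NNReal.toRealHom Y₁ →
      (∀ e : ℝ≥0, 0 < e →
        ¬ perPoly (Fin n) ℝ ∣ MvPolynomial.map NNReal.toRealHom (X₁ + e • Y₁)) →
      (∀ e : ℝ≥0, 0 < e →
        ¬ perPoly (Fin n) ℝ ∣ MvPolynomial.map NNReal.toRealHom (Y₂ + e • X₂)) → False := by
    intro X₁ Y₁ X₂ Y₂ c hc0 hXY hrelXY hY₁ h1 h2
    have hY₁0 : Φ Y₁ ≠ 0 := fun h => hY₁ (per_descent ((hΦ0 Y₁).1 h))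
    -- `per_n ∣ X₁ - c Y₁` over `ℂ`
    have hdiv : perPoly (Fin n) ℂ ∣
        MvPolynomial.map Complex.ofRealHom (MvPolynomial.map NNReal.toRealHom X₁) -
          C c * MvPolynomial.map Complex.ofRealHom (MvPolynomial.map NNReal.toRealHom Y₁) := by
      rw [← Ideal.mem_span_singleton, ← Ideal.Quotient.eq_zero_iff_mem, map_sub, map_mul, ← hΦ,
        ← hΦ, hXY, sub_self]
    -- `c` is real: otherwise `per_n ∣ Y₁`
    have hcim : c.im = 0 := by
      by_contra hcim
      exact hY₁ (dvd_of_map_dvd_sub_C_mul (r := MvPolynomial.map NNReal.toRealHom X₁) hcim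
        (by rwa [map_perPoly]))
    have hc : c = ((c.re : ℝ) : ℂ) := Complex.ext (by simp) (by simp [hcim])
    have hre0 : c.re ≠ 0 := by
      intro hre0
      apply hc0
      rw [hc, hre0, Complex.ofReal_zero]
    rcases lt_or_gt_of_ne hre0 with hneg | hpos
    · -- `c < 0`: `X̄₁ + |c| Ȳ₁ = 0`
      obtain ⟨b, hb0, hb⟩ : ∃ b : ℝ≥0, 0 < b ∧ ((b : ℝ) : ℂ) = -c :=
        ⟨NNReal.mk (-c.re) (by linarith), NNReal.coe_pos.1 (show (0 : ℝ) < -c.re by linarith), by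
          rw [NNReal.coe_mk, Complex.ofReal_neg, ← hc]⟩
      refine h1 b hb0 (per_descent ((hΦ0 _).1 ?_))
      rw [map_add, hΦC, hb, hXY, ← add_mul, ← map_add, ← map_add, add_neg_cancel, map_zero,
        map_zero, zero_mul]
    · -- `c > 0`: `Ȳ₁ (c X̄₂ + Ȳ₂) = 0`, so `Ȳ₂ + c X̄₂ = 0`
      have hk : Φ Y₁ * (Ideal.Quotient.mk (Ideal.span {perPoly (Fin n) ℂ}) (C c) * Φ X₂ + Φ Y₂) =
          0 := by
        rw [← hrelXY, hXY]
        ring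
      have hk' := (mul_eq_zero.1 hk).resolve_left hY₁0
      obtain ⟨b, hb0, hb⟩ : ∃ b : ℝ≥0, 0 < b ∧ ((b : ℝ) : ℂ) = c :=
        ⟨NNReal.mk c.re hpos.le, NNReal.coe_pos.1 (show (0 : ℝ) < c.re from hpos), by
          rw [NNReal.coe_mk, ← hc]⟩
      refine h2 b hb0 (per_descent ((hΦ0 _).1 ?_))
      rw [map_add, hΦC, hb, add_comm]
      exact hk'
  -- §1 hidden rank one: the gcd structure of the UFD `S_n`
  letI := UniqueFactorizationMonoid.toGCDMonoid
    (MvPolynomial (Fin n × Fin n) ℂ ⧸ Ideal.span {perPoly (Fin n) ℂ})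
  obtain ⟨t, u, hst, hsu, htu⟩ := extract_gcd (Φ a₁) (Φ b₁)
  obtain ⟨s, hs⟩ : ∃ s, gcd (Φ a₁) (Φ b₁) = s := ⟨_, rfl⟩
  rw [hs] at hst hsu
  have hs0 : s ≠ 0 := fun h => hA₁ (by rw [hst, h, zero_mul])
  have hu0 : u ≠ 0 := fun h => hB₁ (by rw [hsu, h, mul_zero])
  -- `t ā₂ + u b̄₂ = 0`
  have htu2 : t * Φ a₂ + u * Φ b₂ = 0 := by
    have h : s * (t * Φ a₂ + u * Φ b₂) = 0 := by
      rw [mul_add, ← mul_assoc, ← mul_assoc, ← hst, ← hsu, hrel]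
    exact (mul_eq_zero.1 h).resolve_left hs0
  -- `u ∣ ā₂` by coprimality: `ā₂ = u v`
  have hudvd : u ∣ Φ a₂ := by
    have h1 : u ∣ t * Φ a₂ := ⟨-Φ b₂, by linear_combination htu2⟩
    exact (gcd_isUnit_iff_isRelPrime.1 htu).symm.dvd_of_dvd_mul_left h1
  obtain ⟨v, huv⟩ := hudvd
  -- `b̄₂ = -(t v)`
  have htv : Φ b₂ = -(t * v) := by
    have h : u * (t * v + Φ b₂) = 0 := by
      rw [← htu2, huv]
      ring
    exact eq_neg_of_add_eq_zero_right ((mul_eq_zero.1 h).resolve_left hu0)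
  -- the four factors are non-units
  have hsU : ¬ IsUnit s := by
    -- `s` a unit: `ā₁ ∣ b̄₂`
    intro hsU
    have hd : Φ a₁ ∣ Φ b₂ := by
      rw [hst, hsU.mul_left_dvd, htv]
      exact (dvd_neg).2 (dvd_mul_right t v)
    obtain ⟨c, hc0, hc⟩ := exists_C_mul_of_dvd (hmem a₁ ha₁) (hmem b₂ hb₂) hB₂ hd
    exact hfin b₂ a₁ b₁ a₂ c hc0 hc (by linear_combination hrel) hna₁
      (fun e he => (hcross e he).2.2.1) (fun e he => (hcross e he).2.1)
  have htU : ¬ IsUnit t := by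
    -- `t` a unit: `ā₁ ∣ b̄₁`
    intro htU
    have hd : Φ a₁ ∣ Φ b₁ := by
      rw [hst, htU.mul_right_dvd, hsu]
      exact dvd_mul_right s u
    obtain ⟨c, hc0, hc⟩ := exists_C_mul_of_dvd (hmem a₁ ha₁) (hmem b₁ hb₁) hB₁ hd
    exact hfin a₁ b₁ a₂ b₂ c⁻¹ (inv_ne_zero hc0) (eq_C_inv_mul hc0 hc) hrel hnb₁
      (fun e he => (hcross e he).1) (fun e he => (hcross e he).2.2.2)
  have huU : ¬ IsUnit u := by
    -- `u` a unit: `b̄₁ ∣ ā₁`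
    intro huU
    have hd : Φ b₁ ∣ Φ a₁ := by
      rw [hsu, huU.mul_right_dvd, hst]
      exact dvd_mul_right s t
    obtain ⟨c, hc0, hc⟩ := exists_C_mul_of_dvd (hmem b₁ hb₁) (hmem a₁ ha₁) hA₁ hd
    exact hfin a₁ b₁ a₂ b₂ c hc0 hc hrel hnb₁
      (fun e he => (hcross e he).1) (fun e he => (hcross e he).2.2.2)
  have hvU : ¬ IsUnit v := by
    -- `v` a unit: `ā₂ ∣ b̄₁`
    intro hvU
    have hd : Φ a₂ ∣ Φ b₁ := by
      rw [huv, hvU.mul_right_dvd, hsu]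
      exact dvd_mul_left u s
    obtain ⟨c, hc0, hc⟩ := exists_C_mul_of_dvd (hmem a₂ ha₂) (hmem b₁ hb₁) hB₁ hd
    exact hfin a₂ b₁ a₁ b₂ c⁻¹ (inv_ne_zero hc0) (eq_C_inv_mul hc0 hc) (by linear_combination hrel)
      hnb₁ (fun e he => (hcross e he).2.1) (fun e he => (hcross e he).2.2.1)
  -- §2 reality: complex conjugation `τ` of `S_n` fixes the classes of real polynomials
  obtain ⟨τ, hτ⟩ := exists_conjQuot (perPoly (Fin n) ℂ) (map_perPoly _)
  have hτΦ : ∀ p, τ (Φ p) = Φ p := fun p => by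
    rw [hΦ]
    exact conjQuot_mk_map hτ _
  have hττ : ∀ x, τ (τ x) = x := conjQuot_conjQuot hτ
  -- `τ s ∼ s = gcd(ā₁, b̄₁)`: `τ s = λ s` for a constant `λ`
  have h1 : τ s ∣ s := by
    have ha : τ s ∣ Φ a₁ := by simpa only [hτΦ] using map_dvd τ (⟨t, hst⟩ : s ∣ Φ a₁)
    have hb : τ s ∣ Φ b₁ := by simpa only [hτΦ] using map_dvd τ (⟨u, hsu⟩ : s ∣ Φ b₁)
    simpa only [hs] using dvd_gcd ha hb
  have h2 : s ∣ τ s := by simpa only [hττ] using map_dvd τ h1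
  obtain ⟨w, hw⟩ := associated_of_dvd_dvd h2 h1
  obtain ⟨l, hwl⟩ := exists_C_of_isUnit w.isUnit
  have hτs : τ s = Ideal.Quotient.mk (Ideal.span {perPoly (Fin n) ℂ}) (C l) * s := by
    rw [← hw, hwl, mul_comm]
  -- `λ̄ λ = 1`, from `τ (τ s) = s` and `s ≠ 0`
  have hl1 : (starRingEnd ℂ) l * l = 1 := by
    have h3 : Ideal.Quotient.mk (Ideal.span {perPoly (Fin n) ℂ}) (C ((starRingEnd ℂ) l * l)) * s =
        s := by
      conv_rhs => rw [← hττ s]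
      rw [hτs, map_mul τ, conjQuot_mk_C hτ, hτs, ← mul_assoc,
        ← map_mul (Ideal.Quotient.mk (Ideal.span {perPoly (Fin n) ℂ})), ← C_mul]
    have h4 : (Ideal.Quotient.mk (Ideal.span {perPoly (Fin n) ℂ}) (C ((starRingEnd ℂ) l * l)) - 1) *
        s = 0 := by
      rw [sub_mul, one_mul, h3, sub_self]
    have h5 : Ideal.Quotient.mk (Ideal.span {perPoly (Fin n) ℂ}) (C ((starRingEnd ℂ) l * l - 1)) =
        0 := by
      rw [C_sub, C_1, map_sub, map_one]
      exact (mul_eq_zero.1 h4).resolve_right hs0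
    rw [Ideal.Quotient.eq_zero_iff_mem, Ideal.mem_span_singleton] at h5
    exact sub_eq_zero.1 (eq_zero_of_perPoly_dvd_C (by omega) h5)
  -- rescale by a square root `μ` of `λ` (`μ̄ μ = 1`): `s' = μ s`, `t' = μ̄ t`, `u' = μ̄ u`,
  -- `v' = μ v`
  obtain ⟨μ, hμ, hμ1⟩ := exists_sq_eq_of_conj_mul_self hl1
  obtain ⟨m, hm⟩ : ∃ m, m = Ideal.Quotient.mk (Ideal.span {perPoly (Fin n) ℂ}) (C μ) := ⟨_, rfl⟩
  obtain ⟨m', hm'⟩ :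
      ∃ m', m' = Ideal.Quotient.mk (Ideal.span {perPoly (Fin n) ℂ}) (C ((starRingEnd ℂ) μ)) :=
    ⟨_, rfl⟩
  have hmm : m' * m = 1 := by
    rw [hm, hm', ← map_mul, ← C_mul, hμ1, C_1, map_one]
  have hst' : Φ a₁ = m * s * (m' * t) := by
    rw [hst, ← one_mul (s * t), ← hmm]
    ring
  have hsu' : Φ b₁ = m * s * (m' * u) := by
    rw [hsu, ← one_mul (s * u), ← hmm]
    ring
  have huv' : Φ a₂ = m' * u * (m * v) := by
    rw [huv, ← one_mul (u * v), ← hmm]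
    ring
  have htv' : Φ b₂ = -(m' * t * (m * v)) := by
    rw [htv, ← one_mul (t * v), ← hmm]
    ring
  have hs'0 : m * s ≠ 0 := fun h => hA₁ (by rw [hst', h, zero_mul])
  have ht'0 : m' * t ≠ 0 := fun h => hA₁ (by rw [hst', h, mul_zero])
  have hu'0 : m' * u ≠ 0 := fun h => hB₁ (by rw [hsu', h, mul_zero])
  have hv'0 : m * v ≠ 0 := fun h => hA₂ (by rw [huv', h, mul_zero])
  -- the rescaled factors are fixed by `τ`
  have hτs' : τ (m * s) = m * s := by
    rw [hm, map_mul τ, conjQuot_mk_C hτ, hτs, ← mul_assoc,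
      ← map_mul (Ideal.Quotient.mk (Ideal.span {perPoly (Fin n) ℂ})), ← C_mul, ← hμ, pow_two,
      ← mul_assoc, hμ1, one_mul]
  have hτt' : τ (m' * t) = m' * t := by
    have h := congr_arg τ hst'
    rw [hτΦ, map_mul τ (m * s) (m' * t), hτs', hst'] at h
    exact (mul_left_cancel₀ hs'0 h).symm
  have hτu' : τ (m' * u) = m' * u := by
    have h := congr_arg τ hsu'
    rw [hτΦ, map_mul τ (m * s) (m' * u), hτs', hsu'] at h
    exact (mul_left_cancel₀ hs'0 h).symm
  have hτv' : τ (m * v) = m * v := by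
    have h := congr_arg τ huv'
    rw [hτΦ, map_mul τ (m' * u) (m * v), hτu', huv'] at h
    exact (mul_left_cancel₀ hu'0 h).symm
  -- §3 they are homogeneous, with degrees adding up along `ā₁ = s' t'`, `b̄₁ = s' u'`, `ā₂ = u' v'`
  obtain ⟨ds, dt, hds, hdt, hdst⟩ := exists_mem_mem_of_mul_mem _ (x := m * s) (y := m' * t)
    (d := d) (by rw [← hst']; exact hmem a₁ ha₁) (by rwa [← hst'])
  obtain ⟨ds', du, hds', hdu, hdsu⟩ := exists_mem_mem_of_mul_mem _ (x := m * s) (y := m' * u)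
    (d := d) (by rw [← hsu']; exact hmem b₁ hb₁) (by rwa [← hsu'])
  obtain rfl : ds = ds' := DirectSum.degree_eq_of_mem_mem _ hds hds' hs'0
  obtain ⟨du', dv, hdu', hdv, hduv⟩ := exists_mem_mem_of_mul_mem _ (x := m' * u) (y := m * v)
    (d := d) (by rw [← huv']; exact hmem a₂ ha₂) (by rwa [← huv'])
  obtain rfl : du = du' := DirectSum.degree_eq_of_mem_mem _ hdu hdu' hu'0
  -- real homogeneous representatives of the `τ`-fixed homogeneous classes
  obtain ⟨S, hS, hSe⟩ := exists_real_of_conjQuot_eq hτ hds hτs'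
  obtain ⟨T, hT, hTe⟩ := exists_real_of_conjQuot_eq hτ hdt hτt'
  obtain ⟨U, hU, hUe⟩ := exists_real_of_conjQuot_eq hτ hdu hτu'
  obtain ⟨V, hV, hVe⟩ := exists_real_of_conjQuot_eq hτ hdv hτv'
  -- back to `ℝ[x]` by descent of divisibility
  have hreal : ∀ (p : MvPolynomial (Fin n × Fin n) ℝ≥0) (r : MvPolynomial (Fin n × Fin n) ℝ),
      Φ p = Ideal.Quotient.mk (Ideal.span {perPoly (Fin n) ℂ})
        (MvPolynomial.map Complex.ofRealHom r) →
      perPoly (Fin n) ℝ ∣ MvPolynomial.map NNReal.toRealHom p - r := by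
    intro p r h
    refine per_descent ?_
    rw [← Ideal.mem_span_singleton, map_sub, ← Ideal.Quotient.eq, ← hΦ]
    exact h
  refine ⟨ds, dt, du, dv, S, T, U, V, hS, hT, hU, hV,
    one_le_of_not_isUnit hds hs'0 fun h => hsU (isUnit_of_mul_isUnit_right h),
    one_le_of_not_isUnit hdt ht'0 fun h => htU (isUnit_of_mul_isUnit_right h),
    one_le_of_not_isUnit hdu hu'0 fun h => huU (isUnit_of_mul_isUnit_right h),
    one_le_of_not_isUnit hdv hv'0 fun h => hvU (isUnit_of_mul_isUnit_right h), hdst, hdsu, hduv,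
    hreal a₁ (S * T) (by rw [map_mul, map_mul, hSe, hTe]; exact hst'),
    hreal b₁ (S * U) (by rw [map_mul, map_mul, hSe, hUe]; exact hsu'),
    hreal a₂ (U * V) (by rw [map_mul, map_mul, hUe, hVe]; exact huv'), ?_⟩
  rw [← sub_neg_eq_add]
  exact hreal b₂ (-(T * V)) (by rw [map_neg, map_neg, map_mul, map_mul, hTe, hVe]; exact htv')

end Summit.ValiantsHypothesis.ValiantsHypothesis.Theorems.DivisionGap.PerCofactorDegreeReduction.HiddenRankOneReal

end
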